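import Summits.FinalStateConjecture.FinalStateConjecture.Theorems.ZeroEnergyKerrOrBombStationaryLimitReductionRecutCoveringJunctionCore
import HarnessLib

/-!
# Route ZeroEnergyKerrOrBomb · crux `FinalStateFromKerrOrBomb` (stmt-FinalStateConjecture-17839), line
# `SketchIdeator1` — stub `stub_recutJunctionCoreCO`, wave 5: FLAT STEERING of radiation-zone events with
# isochronous motions (case F of the junction core over the chart-overlap clause)

Helper file (`--supports stmt-FinalStateConjecture-17839`; registered helper `recutJunction_flatSteer`) of the
lead's wave-5 stub worker W16 (2026-08-17). See `work/stubs/W16-report.md`.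

Setting: a stationary decomposition `d` with Kerr identifications `Θᵢ` (`IsKerrChartedWith`, time scale
`cᵢ = 1`), radii `Rᵢ` (monotone, `→ ∞`, overlap-margin clause (iii) of `HasExhaustiveDocCharts'`), the
chart-overlap clauses (a) (hole/flat charts agree at doubly-late coordinates), (b) (no double coordinates
hole/flat) and (e⁺) (late flat coordinates are d.o.c.-part coordinates of every hole), and ISOCHRONOUS
motions `Λᵢ e₀ = e₀` (the companion file `…RecutCoreCOIsochronous.lean` derives this from (iii) + (a) + (b) +
(e⁺): with the unbounded far shells of (iii) as typed, a hole whose motion tilts the time axis contradicts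
the agreement clause). Three earlier bricks enter as HYPOTHESES (their modules are accepted but unbuilt):
the flat time-line brick (p143586, `recutJunction_flatTimeLine_slab`), ingredient (α) in the merged form
`r ≥ r₊ + δ` (p141985, `recutJunction_holeTube_rPlus_slab`, fed by p141608/p142035/`kerr_drsrVector_uniform`),
and the near-horizon residual (NH) of W15's report (open).

Conclusion (`recutJunction_flatSteer`, case F of the W15/W16 plan): for all margins `s, W` and windows `K`
there is `τC` such that for `τ₁ ≥ τC` every flat event `Ψ₀ y` of lab time `y⁰ ∈ [τ₁ − K, τ₁]` which is NOT
in the recut certified late region `Ω(τ₁)` (radii `R'ᵢ τ = Rᵢ(cᵢ τ − s) − W`) lies in `J⁻(recutCertifiedSlab … τ₁)`.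
Proof: if the vertical coordinate segment from `y` up to lab time `τ₁` stays in the flat domain `U₀`, the
flat brick applies. Otherwise some point `y + t e₀ ∉ U₀`, `0 ≤ t ≤ K`; with isochronous motions the
rest-frame adapted radius is constant along lab verticals and `y + t e₀` is again a d.o.c.-part coordinate
of every hole (equivariance of `Θᵢ`), so (iii) + (b) at the rest time of `y + t e₀` force `y` to be DEEP in
the old certified tube of a hole `i` (`Aᵢ.radius < Rᵢ(σ + t − s₀) − W'`, §2); then the Kerr–Schild time of
`y` is `≤ τ₁` (else `Ψ₀ y = ψᵢ y ∈ Ω` by (a)), its Kerr–Schild radius is `≤ R'ᵢ τ₁`, and (α) / (NH) steer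
`ψᵢ y = Ψ₀ y` to the recut slab.

Elementary; no named fact, nothing restated. Reference: Dafermos–Luk arXiv:1710.01722, Conjecture 1 (b)–(c)
(late-time multi-chart bookkeeping; formalisation-internal).
-/

set_option linter.dupNamespace false

noncomputable section

open scoped Manifold ContDiff Topology
open Set Filter Function

namespace Summit.FinalStateConjecture.FinalStateConjecture.Theorems.SymplecticDualOfTheBomb

open Literature.Geometry.Lorentzian Summit.FinalStateConjecture.FinalStateConjecture.Theorems.OneLockedExplosion

/-! ## §1 Isochronous motions: lab time = rest time + offset, lab verticals = rest verticals -/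

section Iso

variable {Λ : lorentzGroup}

/-- An isochronous Lorentz transformation (`Λ e₀ = e₀`) preserves the time coordinate: `(Λ v)⁰ = v⁰`
(`η(e₀, Λ v) = η(Λ e₀, Λ v) = η(e₀, v)`). [folklore] -/
theorem lorentz_apply_zero_of_map_basisVector (hΛ : (Λ : E4 ≃L[ℝ] E4) (E4.basisVector 0) = E4.basisVector 0)
    (v : E4) : (Λ : E4 ≃L[ℝ] E4) v 0 = v 0 := by
  have h := Λ.2 (E4.basisVector 0) v
  rw [hΛ, Minkowski.bilin_basisVector_zero_left, Minkowski.bilin_basisVector_zero_left] at h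
  linarith

/-- The inverse of an isochronous Lorentz transformation preserves the time coordinate. [folklore] -/
theorem lorentz_symm_apply_zero_of_map_basisVector (hΛ : (Λ : E4 ≃L[ℝ] E4) (E4.basisVector 0) = E4.basisVector 0)
    (v : E4) : (Λ : E4 ≃L[ℝ] E4).symm v 0 = v 0 := by
  have h := lorentz_apply_zero_of_map_basisVector hΛ ((Λ : E4 ≃L[ℝ] E4).symm v)
  rw [ContinuousLinearEquiv.apply_symm_apply] at h
  exact h.symm

/-- Rest time of an isochronous motion: `(P⁻¹ y)⁰ = y⁰ − c⁰`. [folklore] -/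
theorem poincareInv_apply_zero_of_map_basisVector (hΛ : (Λ : E4 ≃L[ℝ] E4) (E4.basisVector 0) = E4.basisVector 0)
    (c₀ y : E4) : poincareInv Λ c₀ y 0 = y 0 - c₀ 0 := by
  rw [poincareInv, lorentz_symm_apply_zero_of_map_basisVector hΛ]
  rfl

/-- Lab verticals are rest verticals for an isochronous motion: `P⁻¹ (y + t e₀) = P⁻¹ y + t e₀`. [folklore] -/
theorem poincareInv_add_smul_basisVector_of_map_basisVector
    (hΛ : (Λ : E4 ≃L[ℝ] E4) (E4.basisVector 0) = E4.basisVector 0) (c₀ y : E4) (t : ℝ) :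
    poincareInv Λ c₀ (y + t • E4.basisVector 0) = poincareInv Λ c₀ y + t • E4.basisVector 0 := by
  have h := poincareInv_add_smul Λ c₀ y (E4.basisVector 0) t
  rwa [hΛ] at h

end Iso

/-! ## §2 Coordinates of the Kerr identification: radius comparison and the recut tube -/

section Coordinates

variable {𝓢 : Spacetime.{0} 4} {O : Set 𝓢.carrier} {k : ℕ}

/-- **Two-sided radius comparison.** For `IsKerrChartedWith 𝓑 A M a c r₀ Θ` there is `L₂` with
`r(u) ≤ A.radius (Θ u) + L₂` on the whole Kerr exterior (far out by the asymptotic-control clause; on the strip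
`r < r₊ + 1` because `A.radius ≥ ‖·‖ − C ≥ −C`). [folklore] -/
theorem kerrChartedWith_radius_le_adaptedRadius_add {𝓑 : StationaryAFBlackHole.{0}} {A : 𝓑.AdaptedChart}
    {M a c r₀ : ℝ} {Θ : E4 → E4} (h : IsKerrChartedWith 𝓑 A M a c r₀ Θ) :
    ∃ L₂ : ℝ, 0 ≤ L₂ ∧ ∀ u ∈ (Kerr.exterior M a : Set E4), Kerr.radius a u ≤ A.radius (Θ u) + L₂ := by
  obtain ⟨hsub, -, -, -, -, -, -, -, -, -, L, hL⟩ := h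
  obtain ⟨C, hC⟩ := A.exists_abs_radius_sub_spatialNorm_le
  have hrp : 0 < Kerr.rPlus M a := hsub.pos.trans_le (le_add_of_nonneg_right (Real.sqrt_nonneg _))
  refine ⟨|L| + |C| + Kerr.rPlus M a + 1, by positivity, fun u hu ↦ ?_⟩
  by_cases hfar : Kerr.rPlus M a + 1 ≤ Kerr.radius a u
  · have h1 := (abs_le.1 (hL u hu hfar).2.1).1
    linarith [le_abs_self L, abs_nonneg C]
  · have h1 := (abs_le.1 (hC (Θ u))).1
    have h2 : 0 ≤ E4.spatialNorm (Θ u) := E4.spatialNorm_nonneg _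
    linarith [le_abs_self C, abs_nonneg L, not_le.1 hfar]

variable (d : StationaryFinalStateDecomposition 𝓢 O k) {M a c r₀ : Fin d.N → ℝ} {Θ : Fin d.N → E4 → E4}

/-- A d.o.c.-part coordinate of hole `i` has Kerr–Schild coordinates: `P⁻¹ y = Θᵢ x`, `x ∈ Kerr.exterior`
(anchor clause of `IsKerrChartedWith`). [folklore] -/
theorem exists_kerr_of_mem_docPart {i : Fin d.N}
    (hW : IsKerrChartedWith (d.hole i) (d.adapted i) (M i) (a i) (c i) (r₀ i) (Θ i))
    {y : (d.background i).domain} (hy : y ∈ docPart d i) :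
    ∃ x ∈ (Kerr.exterior (M i) (a i) : Set E4), Θ i x = poincareInv (d.motion i).1 (d.motion i).2 y.1 := by
  have h : poincareInv (d.motion i).1 (d.motion i).2 y.1 ∈ Θ i '' (Kerr.exterior (M i) (a i) : Set E4) := by
    rw [hW.2.2.2.2.2.2.2.2.2.1]; exact hy
  obtain ⟨x, hx, hxy⟩ := h
  exact ⟨x, hx, hxy⟩

/-- Conversely the moved identification point `Pᵢ (Θᵢ x)`, `x ∈ Kerr.exterior`, is a d.o.c.-part coordinate of
hole `i` (anchor clause). [folklore] -/
theorem mem_docPart_of_kerr {i : Fin d.N}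
    (hW : IsKerrChartedWith (d.hole i) (d.adapted i) (M i) (a i) (c i) (r₀ i) (Θ i))
    {x : E4} (hx : x ∈ (Kerr.exterior (M i) (a i) : Set E4))
    (h₀ : ((d.motion i).1 : E4 ≃L[ℝ] E4) (Θ i x) + (d.motion i).2 ∈ (d.background i).domain) :
    (⟨((d.motion i).1 : E4 ≃L[ℝ] E4) (Θ i x) + (d.motion i).2, h₀⟩ : (d.background i).domain) ∈ docPart d i := by
  have h : Θ i x ∈ Θ i '' (Kerr.exterior (M i) (a i) : Set E4) := mem_image_of_mem _ hx
  rw [hW.2.2.2.2.2.2.2.2.2.1] at h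
  obtain ⟨h1, h2⟩ := h
  show ∃ h : poincareInv (d.motion i).1 (d.motion i).2 (((d.motion i).1 : E4 ≃L[ℝ] E4) (Θ i x) + (d.motion i).2) ∈
    (d.adapted i).domain, (d.adapted i).toFun ⟨_, h⟩ ∈ (d.hole i).doc
  rw [poincareInv_apply_add]
  exact ⟨h1, h2⟩

/-- The moved identification point `Pᵢ (Θᵢ x)`, `x ∈ Kerr.exterior`, lies in the moved adapted domain. [folklore] -/
theorem poincare_kerr_mem_domain {i : Fin d.N}
    (hW : IsKerrChartedWith (d.hole i) (d.adapted i) (M i) (a i) (c i) (r₀ i) (Θ i))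
    {x : E4} (hx : x ∈ (Kerr.exterior (M i) (a i) : Set E4)) :
    ((d.motion i).1 : E4 ≃L[ℝ] E4) (Θ i x) + (d.motion i).2 ∈ (d.background i).domain := by
  obtain ⟨-, -, -, hr₀, -, -, hΘm, -⟩ := hW
  show poincareInv (d.motion i).1 (d.motion i).2 _ ∈ ((d.adapted i).domain : Set E4)
  rw [poincareInv_apply_add]
  exact hΘm (Kerr.mem_region.2 ((max_le_max hr₀.le le_rfl).trans_lt (Kerr.mem_exterior.1 hx)))

/-- `Θᵢ` maps the Kerr exterior into the adapted chart domain. [folklore] -/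
theorem kerr_mem_adaptedDomain {i : Fin d.N}
    (hW : IsKerrChartedWith (d.hole i) (d.adapted i) (M i) (a i) (c i) (r₀ i) (Θ i))
    {x : E4} (hx : x ∈ (Kerr.exterior (M i) (a i) : Set E4)) : Θ i x ∈ ((d.adapted i).domain : Set E4) := by
  obtain ⟨-, -, -, hr₀, -, -, hΘm, -⟩ := hW
  exact hΘm (Kerr.mem_region.2 ((max_le_max hr₀.le le_rfl).trans_lt (Kerr.mem_exterior.1 hx)))

/-- `T`-equivariance with unit time scale: `Θᵢ (x + t e₀) = Θᵢ x + t e₀` on the Kerr exterior when `cᵢ = 1`.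
[folklore] -/
theorem kerr_apply_add_smul {i : Fin d.N}
    (hW : IsKerrChartedWith (d.hole i) (d.adapted i) (M i) (a i) (c i) (r₀ i) (Θ i)) (hc1 : c i = 1)
    {x : E4} (hx : x ∈ (Kerr.exterior (M i) (a i) : Set E4)) (t : ℝ) :
    Θ i (x + t • E4.basisVector 0) = Θ i x + t • E4.basisVector 0 := by
  obtain ⟨-, -, -, hr₀, -, -, -, hΘe, -⟩ := hW
  have h := hΘe x (Kerr.mem_region.2 ((max_le_max hr₀.le le_rfl).trans_lt (Kerr.mem_exterior.1 hx))) t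
  rwa [hc1, one_mul] at h

/-- **Membership in the recut certified tube.** The old chart point of `Pᵢ (Θᵢ x)` with Kerr–Schild time
`x⁰ > τ₁` and Kerr–Schild radius `r(x) ≤ R'ᵢ x⁰` lies in `recutCertifiedLate d M a Θ R' τ₁`. [folklore] -/
theorem chart_mem_recutCertifiedLate_of_kerr {i : Fin d.N} (R' : Fin d.N → ℝ → ℝ) {τ₁ : ℝ}
    {x : E4} (hx : x ∈ (Kerr.exterior (M i) (a i) : Set E4)) (hx0 : τ₁ < x 0)
    (hxr : Kerr.radius (a i) x ≤ R' i (x 0))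
    (h₀ : ((d.motion i).1 : E4 ≃L[ℝ] E4) (Θ i x) + (d.motion i).2 ∈ (d.background i).domain) :
    d.toOver.chart i ⟨((d.motion i).1 : E4 ≃L[ℝ] E4) (Θ i x) + (d.motion i).2, h₀⟩ ∈
      recutCertifiedLate d M a Θ R' τ₁ := by
  set z : E4 := ((d.motion i).1 : E4 ≃L[ℝ] E4) x + (d.motion i).2 with hz
  have hPz : poincareInv (d.motion i).1 (d.motion i).2 z = x := poincareInv_apply_add _ _ _
  have hzdom : z ∈ ((recutBackground d M a i).domain : Set E4) := by
    show poincareInv (d.motion i).1 (d.motion i).2 z ∈ (Kerr.exterior (M i) (a i) : Set E4)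
    rw [hPz]; exact hx
  refine Or.inr (mem_iUnion.2 ⟨i, mem_image_of_mem _ ?_⟩)
  refine ⟨z, ⟨⟨z, hzdom⟩, ⟨?_, ?_⟩, rfl⟩, ?_⟩
  · show τ₁ < (poincareInv (d.motion i).1 (d.motion i).2 z) 0
    rw [hPz]; exact hx0
  · show Kerr.radius (a i) (poincareInv (d.motion i).1 (d.motion i).2 z) ≤
      R' i ((poincareInv (d.motion i).1 (d.motion i).2 z) 0)
    rw [hPz]; exact hxr
  · show ((d.motion i).1 : E4 ≃L[ℝ] E4) (Θ i (poincareInv (d.motion i).1 (d.motion i).2 z)) + (d.motion i).2 = _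
    rw [hPz]

end Coordinates

/-! ## §3 Case F: flat steering of flat events of lab time `∈ [τ₁ − K, τ₁]` outside the recut late region -/

/-- **Registered helper `recutJunction_flatSteer` (case F of the junction core over the chart-overlap clause,
isochronous motions).** Hypotheses: monotone radii `Rᵢ → ∞`, the overlap-margin clause (iii), Kerr
identifications with `cᵢ = 1`, isochronous motions `Λᵢ e₀ = e₀`, the chart-overlap clauses (a), (b), (e⁺), and
— as hypotheses — the conclusions of the flat time-line brick (p143586), of ingredient (α) for `r ≥ r₊ + δ`
(p141985) and the near-horizon residual (NH). Conclusion: for all `s W K` there is `τC` such that for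
`τ₁ ≥ τC` a flat event `Ψ₀ y` with `τ₁ − K ≤ y⁰ ≤ τ₁` outside `recutCertifiedLate … R' τ₁`,
`R'ᵢ τ = Rᵢ(cᵢ τ − s) − W`, lies in `J⁻(recutCertifiedSlab … R' τ₁)`. [folklore] -/
theorem recutJunction_flatSteer : ∀ {𝓢 : Spacetime.{0} 4} {O : Set 𝓢.carrier} {k : ℕ} (d : StationaryFinalStateDecomposition 𝓢 O k) (M a c r₀ : Fin d.N → ℝ) (Θ : Fin d.N → E4 → E4) (R : Fin d.N → ℝ → ℝ), (∀ i, Monotone (R i)) → (∀ i, Tendsto (R i) atTop atTop) → (∀ i, ∀ W s₀ : ℝ, ∀ᶠ σ in atTop, d.toOver.chart i '' ({x | (d.background i).time x.1 = σ ∧ R i (σ - s₀) - W ≤ (d.background i).radius x.1} ∩ docPart d i) ⊆ d.toOver.radiationZone) → (∀ i, IsKerrChartedWith (d.hole i) (d.adapted i) (M i) (a i) (c i) (r₀ i) (Θ i)) → (∀ i, c i = 1) → (∀ i, ((d.motion i).1 : E4 ≃L[ℝ] E4) (E4.basisVector 0) = E4.basisVector 0) → (∀ (i : Fin d.N) (y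 : (d.background i).domain) (h : (y : E4) ∈ d.toOver.flatDomain), d.toOver.τ₀ < (d.background i).time y.1 → d.toOver.τ₀ < (y : E4) 0 → d.toOver.chart i y = d.toOver.flatChart ⟨y, h⟩) → (∀ (i : Fin d.N) (y : (d.background i).domain) (y' : d.toOver.flatDomain), d.toOver.τ₀ < (d.background i).time y.1 → d.toOver.τ₀ < (y : E4) 0 → d.toOver.τ₀ < (y' : E4) 0 → d.toOver.chart i y = d.toOver.flatChart y' → (y : E4) = y') → (∀ y : d.toOver.flatDomain, d.toOver.τ₀ < (y : E4) 0 → ∀ i : Fin d.N, ∃ h : (y : E4) ∈ (d.background i).domain, (⟨(y : E4), h⟩ : (d.background i).domain) ∈ docPart d i) → (∃ τF : ℝ, d.toOver.τ₀ < τF ∧ ∀ (M a : Fin d.N → ℝ) (Θ : Fin d.N → E4 → E4) (R' : Fin d.N → ℝ → ℝ) (τ₁ : ℝ) (y : d.toOver.flatDomain), τF ≤ (y : E4) 0 → (y : E4) 0 ≤ τ₁ → (∀ s ∈ Set.Icc (0 : ℝ) (τ₁ - (y : E4) 0), (y : E4) + s • E4.basisVector 0 ∈ (d.toOver.flatDomain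 : Set E4)) → d.toOver.flatChart y ∈ 𝓢.metric.causalPast 𝓢.timeOrientation (recutCertifiedSlab d M a Θ R' τ₁)) → (∀ (i : Fin d.N) (δ : ℝ), 0 < δ → ∃ T : ℝ, ∀ (R' : Fin d.N → ℝ → ℝ) (τ₁ : ℝ), ∀ x ∈ (Kerr.exterior (M i) (a i) : Set E4), Kerr.rPlus (M i) (a i) + δ ≤ Kerr.radius (a i) x → T ≤ Θ i x 0 → (d.adapted i).radius (Θ i x) ≤ R i (Θ i x 0) → x 0 ≤ τ₁ → Kerr.radius (a i) x ≤ R' i τ₁ → ∀ h₀ : ((d.motion i).1 : E4 ≃L[ℝ] E4) (Θ i x) + (d.motion i).2 ∈ (d.background i).domain, d.toOver.chart i ⟨((d.motion i).1 : E4 ≃L[ℝ] E4) (Θ i x) + (d.motion i).2, h₀⟩ ∈ 𝓢.metric.causalPast 𝓢.timeOrientation (recutCertifiedSlab d M a Θ R' τ₁)) → (∀ i : Fin d.N, ∃ δ T : ℝ, 0 < δ ∧ ∀ (R' : Fin d.N → ℝ → ℝ) (τ₁ : ℝ), ∀ x ∈ (Kerr.exterior (M i) (a i) : Set E4), Kerr.radius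 (a i) x < Kerr.rPlus (M i) (a i) + δ → T ≤ Θ i x 0 → (d.adapted i).radius (Θ i x) ≤ R i (Θ i x 0) → x 0 ≤ τ₁ → Kerr.rPlus (M i) (a i) + 1 ≤ R' i τ₁ → ∀ h₀ : ((d.motion i).1 : E4 ≃L[ℝ] E4) (Θ i x) + (d.motion i).2 ∈ (d.background i).domain, d.toOver.chart i ⟨((d.motion i).1 : E4 ≃L[ℝ] E4) (Θ i x) + (d.motion i).2, h₀⟩ ∈ 𝓢.metric.causalPast 𝓢.timeOrientation (recutCertifiedSlab d M a Θ R' τ₁)) → ∀ s W K : ℝ, ∃ τC : ℝ, ∀ (τ₁ : ℝ) (y : d.toOver.flatDomain), τC ≤ τ₁ → τ₁ - K ≤ (y : E4) 0 → (y : E4) 0 ≤ τ₁ → d.toOver.flatChart y ∉ recutCertifiedLate d M a Θ (fun i τ ↦ R i (c i * τ - s) - W) τ₁ → d.toOver.flatChart y ∈ 𝓢.metric.causalPast 𝓢.timeOrientation (recutCertifiedSlab d M a Θ (fun i τ ↦ R i (c i * τ - s) - W) τ₁) := by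
  intro 𝓢 O k d M a c r₀ Θ R hRmono hRtop hiii hW hc1 hiso ha hb he hflat hα hNH s W K
  -- the transported radii, read with `cᵢ = 1`
  set R' : Fin d.N → ℝ → ℝ := fun i τ ↦ R i (c i * τ - s) - W with hR'_def
  have hR' : ∀ i τ, R' i τ = R i (τ - s) - W := fun i τ ↦ by simp [hR'_def, hc1 i]
  -- constants of the identifications: tilt `L₁`, radius comparison `L₂`, offsets `κ`
  have hglob := fun i ↦ kerrChartedWith_global_bounds (hW i)
  choose L₁ hL₁0 hL₁ using hglob
  have hrad := fun i ↦ kerrChartedWith_radius_le_adaptedRadius_add (hW i)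
  choose L₂ hL₂0 hL₂ using hrad
  obtain ⟨L', hL'⟩ := Finite.exists_le fun i ↦ max (L₁ i) (L₂ i)
  obtain ⟨κ', hκ'⟩ := Finite.exists_le fun i : Fin d.N ↦ |(d.motion i).2 0|
  set L : ℝ := max L' 0 with hL_def
  set κ : ℝ := max κ' 0 with hκ_def
  have hL0 : 0 ≤ L := le_max_right _ _
  have hκ0 : 0 ≤ κ := le_max_right _ _
  have hκi : ∀ i, |(d.motion i).2 0| ≤ κ := fun i ↦ (hκ' i).trans (le_max_left _ _)
  have htilt : ∀ i, ∀ u ∈ (Kerr.exterior (M i) (a i) : Set E4), |Θ i u 0 - u 0| ≤ L := fun i u hu ↦ by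
    have h := (hL₁ i u hu).1
    rw [hc1 i, one_mul] at h
    exact h.trans ((le_max_left _ _).trans ((hL' i).trans (le_max_left _ _)))
  have hradle : ∀ i, ∀ u ∈ (Kerr.exterior (M i) (a i) : Set E4),
      Kerr.radius (a i) u ≤ (d.adapted i).radius (Θ i u) + L :=
    fun i u hu ↦ by
    have h1 : L₂ i ≤ L := (le_max_right _ _).trans ((hL' i).trans (le_max_left _ _))
    linarith [hL₂ i u hu]
  -- the steering data of (α) and (NH), hole by hole
  choose δ TN hδ hTN using hNH
  have hα' := fun i ↦ hα i (δ i) (hδ i)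
  choose Tα hTα using hα'
  -- margins for clause (iii)
  set K' : ℝ := max K 0 with hK'
  set s₀ : ℝ := max s 0 + κ + L + K' with hs₀
  set W' : ℝ := max (W + L) 0 with hW'
  have hiii' := fun i ↦ eventually_atTop.1 ((hiii i W' s₀).and (eventually_gt_atTop d.toOver.τ₀))
  choose Sg hSg using hiii'
  -- growth of the radii: `r₊ + 1 + W ≤ Rᵢ τ` for late `τ`
  have hgrow := fun i ↦ eventually_atTop.1 ((hRtop i).eventually_ge_atTop (Kerr.rPlus (M i) (a i) + 1 + W))
  choose TR hTR using hgrow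
  -- the flat brick
  obtain ⟨τF, hτF, hflat⟩ := hflat
  -- thresholds
  obtain ⟨T₁, hT₁⟩ := Finite.exists_le fun i ↦ max (max (Sg i) (TR i + s)) (max (TN i) (Tα i))
  set T₀ : ℝ := max (max τF (d.toOver.τ₀ + 1)) T₁ with hT₀
  refine ⟨T₀ + K' + κ + L + 1, fun τ₁ y hτ₁ hyK hyτ hΩ ↦ ?_⟩
  have hK'K : K ≤ K' := le_max_left _ _
  have hK'0 : 0 ≤ K' := le_max_right _ _
  have hs0 : s ≤ max s 0 := le_max_left _ _
  have hs0' : 0 ≤ max s 0 := le_max_right _ _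
  have hW'0 : 0 ≤ W' := le_max_right _ _
  have hW'W : W + L ≤ W' := le_max_left _ _
  have hT₀F : τF ≤ T₀ := (le_max_left _ _).trans (le_max_left _ _)
  have hT₀τ : d.toOver.τ₀ + 1 ≤ T₀ := (le_max_right _ _).trans (le_max_left _ _)
  have hT₀1 : T₁ ≤ T₀ := le_max_right _ _
  have hi1 : ∀ i, Sg i ≤ T₁ ∧ TR i + s ≤ T₁ ∧ TN i ≤ T₁ ∧ Tα i ≤ T₁ := fun i ↦
    ⟨(le_max_left _ _).trans ((le_max_left _ _).trans (hT₁ i)),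
      (le_max_right _ _).trans ((le_max_left _ _).trans (hT₁ i)),
      (le_max_left _ _).trans ((le_max_right _ _).trans (hT₁ i)),
      (le_max_right _ _).trans ((le_max_right _ _).trans (hT₁ i))⟩
  have hy0 : τ₁ - K' ≤ (y : E4) 0 := by linarith
  have hyT : T₀ + κ + L + 1 ≤ (y : E4) 0 := by linarith
  have hylate : d.toOver.τ₀ < (y : E4) 0 := by linarith
  -- case F1: the vertical segment up to lab time `τ₁` stays in the flat domain
  by_cases hseg : ∀ t ∈ Icc (0 : ℝ) (τ₁ - (y : E4) 0),
      (y : E4) + t • E4.basisVector 0 ∈ (d.toOver.flatDomain : Set E4)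
  · exact hflat M a Θ R' τ₁ y (by linarith) hyτ hseg
  -- case F2: some point `y + t e₀` of the segment is not a flat coordinate
  push Not at hseg
  obtain ⟨t, ht, hV⟩ := hseg
  have hV0 : ((y : E4) + t • E4.basisVector 0) 0 = (y : E4) 0 + t := by simp [E4.basisVector]
  obtain ⟨i⟩ : Nonempty (Fin d.N) := by
    by_contra hN
    refine hV (d.toOver.setOf_lt_excision_subset_flatDomain ⟨?_, fun i ↦ (hN ⟨i⟩).elim⟩)
    show d.toOver.τ₀ < ((y : E4) + t • E4.basisVector 0) 0
    rw [hV0]; linarith [ht.1]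
  -- `y` is a d.o.c.-part coordinate of hole `i`, with Kerr–Schild coordinate `x`
  obtain ⟨hydom, hydoc⟩ := he y hylate i
  obtain ⟨x, hx, hΘx⟩ := exists_kerr_of_mem_docPart d (hW i) hydoc
  have hrest : poincareInv (d.motion i).1 (d.motion i).2 (y : E4) 0 = (y : E4) 0 - (d.motion i).2 0 :=
    poincareInv_apply_zero_of_map_basisVector (hiso i) _ _
  set σ : ℝ := (y : E4) 0 - (d.motion i).2 0 with hσ
  have hΘx0 : Θ i x 0 = σ := by rw [hΘx, hrest]
  have hc0 := abs_le.1 (hκi i)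
  have hσy : σ ≤ (y : E4) 0 + κ := by rw [hσ]; linarith [hc0.1]
  have hσy' : (y : E4) 0 - κ ≤ σ := by rw [hσ]; linarith [hc0.2]
  have hσlate : d.toOver.τ₀ < σ := by linarith
  have hyrest : d.toOver.τ₀ < (d.background i).time (y : E4) := by
    show d.toOver.τ₀ < poincareInv (d.motion i).1 (d.motion i).2 (y : E4) 0
    rw [hrest]; exact hσlate
  have hx0 := abs_le.1 (htilt i x hx)
  rw [hΘx0] at hx0
  obtain ⟨hSg1, hTR1, hTN1, hTα1⟩ := hi1 i
  have hPy : ((d.motion i).1 : E4 ≃L[ℝ] E4) (Θ i x) + (d.motion i).2 = (y : E4) := by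
    rw [hΘx, apply_poincareInv_add]
  -- §2: `y` is DEEP in the old certified tube of hole `i`
  have hdeep : (d.adapted i).radius (Θ i x) < R i (σ + t - s₀) - W' := by
    by_contra hge
    push Not at hge
    have hxt : x + t • E4.basisVector 0 ∈ (Kerr.exterior (M i) (a i) : Set E4) :=
      Kerr.add_smul_basisVector_zero_mem_region hx t
    have hΘxt : Θ i (x + t • E4.basisVector 0) =
        poincareInv (d.motion i).1 (d.motion i).2 ((y : E4) + t • E4.basisVector 0) := by
      rw [poincareInv_add_smul_basisVector_of_map_basisVector (hiso i), ← hΘx, kerr_apply_add_smul d (hW i) (hc1 i) hx]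
    have hVdom : poincareInv (d.motion i).1 (d.motion i).2 ((y : E4) + t • E4.basisVector 0) ∈
        ((d.adapted i).domain : Set E4) := by
      rw [← hΘxt]; exact kerr_mem_adaptedDomain d (hW i) hxt
    set V : (d.background i).domain := ⟨(y : E4) + t • E4.basisVector 0, hVdom⟩ with hV_def
    have hPV : ((d.motion i).1 : E4 ≃L[ℝ] E4) (Θ i (x + t • E4.basisVector 0)) + (d.motion i).2 =
        (y : E4) + t • E4.basisVector 0 := by
      rw [hΘxt, apply_poincareInv_add]
    have hVdoc : V ∈ docPart d i := by
      have key : ∀ V' : (d.background i).domain,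
          (V' : E4) = ((d.motion i).1 : E4 ≃L[ℝ] E4) (Θ i (x + t • E4.basisVector 0)) + (d.motion i).2 →
            V' ∈ docPart d i := by
        rintro ⟨v, hv⟩ rfl
        exact mem_docPart_of_kerr d (hW i) hxt hv
      exact key V hPV.symm
    have hVtime : (d.background i).time V.1 = σ + t := by
      show poincareInv (d.motion i).1 (d.motion i).2 ((y : E4) + t • E4.basisVector 0) 0 = σ + t
      rw [poincareInv_apply_zero_of_map_basisVector (hiso i), hV0, hσ]; ring
    have hVrad : (d.background i).radius V.1 = (d.adapted i).radius (Θ i x) := by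
      show (d.adapted i).radius (poincareInv (d.motion i).1 (d.motion i).2 ((y : E4) + t • E4.basisVector 0)) = _
      rw [poincareInv_add_smul_basisVector_of_map_basisVector (hiso i), ← hΘx, adaptedRadius_add_smul_basisVector]
    obtain ⟨hsub, hσtτ₀⟩ := hSg i (σ + t) (by linarith [ht.1])
    have hmem : d.toOver.chart i V ∈ d.toOver.radiationZone :=
      hsub (mem_image_of_mem _ ⟨⟨hVtime, by rw [hVrad]; exact hge⟩, hVdoc⟩)
    obtain ⟨y'', hy'', heq⟩ := hmem
    have hVlate : d.toOver.τ₀ < (d.background i).time V.1 := by rw [hVtime]; exact hσtτ₀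
    have hVlab : d.toOver.τ₀ < (V : E4) 0 := by
      show d.toOver.τ₀ < ((y : E4) + t • E4.basisVector 0) 0
      rw [hV0]; linarith [ht.1]
    have hVy'' : (V : E4) = y'' := hb i V y'' hVlate hVlab hy'' heq.symm
    have hVU : (V : E4) ∈ (d.toOver.flatDomain : Set E4) := by rw [hVy'']; exact y''.2
    exact hV hVU
  -- consequences of deepness: (1) old tube, (2) recut radius, (3) Kerr–Schild time `≤ τ₁`
  have h1 : (d.adapted i).radius (Θ i x) ≤ R i (Θ i x 0) := by
    rw [hΘx0]
    have hmono : R i (σ + t - s₀) ≤ R i σ := hRmono i (by rw [hs₀]; linarith [ht.2])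
    linarith
  have h2 : Kerr.radius (a i) x ≤ R' i τ₁ := by
    rw [hR']
    have hmono : R i (σ + t - s₀) ≤ R i (τ₁ - s) := hRmono i (by rw [hs₀]; linarith [ht.2])
    linarith [hradle i x hx]
  have h3 : x 0 ≤ τ₁ := by
    by_contra hgt
    push Not at hgt
    apply hΩ
    have hmono : R i (σ + t - s₀) ≤ R i (x 0 - s) := hRmono i (by rw [hs₀]; linarith [ht.2])
    have hxr : Kerr.radius (a i) x ≤ R' i (x 0) := by rw [hR']; linarith [hradle i x hx]
    have key : ∀ y' : (d.background i).domain,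
        (y' : E4) = ((d.motion i).1 : E4 ≃L[ℝ] E4) (Θ i x) + (d.motion i).2 →
          d.toOver.chart i y' ∈ recutCertifiedLate d M a Θ R' τ₁ := by
      rintro ⟨v, hv⟩ rfl
      exact chart_mem_recutCertifiedLate_of_kerr d R' hx hgt hxr hv
    have h := key ⟨(y : E4), hydom⟩ hPy.symm
    rwa [ha i ⟨(y : E4), hydom⟩ y.2 hyrest hylate] at h
  -- (4) steering by (α) / (NH) from `y` itself
  have key : ∀ y' : (d.background i).domain,
      (y' : E4) = ((d.motion i).1 : E4 ≃L[ℝ] E4) (Θ i x) + (d.motion i).2 →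
        d.toOver.chart i y' ∈ 𝓢.metric.causalPast 𝓢.timeOrientation (recutCertifiedSlab d M a Θ R' τ₁) := by
    rintro ⟨v, hv⟩ rfl
    by_cases hr : Kerr.rPlus (M i) (a i) + δ i ≤ Kerr.radius (a i) x
    · exact hTα i R' τ₁ x hx hr (by rw [hΘx0]; linarith) h1 h3 h2 hv
    · refine hTN i R' τ₁ x hx (not_le.1 hr) (by rw [hΘx0]; linarith) h1 h3 ?_ hv
      rw [hR']
      linarith [hTR i (τ₁ - s) (by linarith)]
  have h := key ⟨(y : E4), hydom⟩ hPy.symm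
  rwa [ha i ⟨(y : E4), hydom⟩ y.2 hyrest hylate] at h

end Summit.FinalStateConjecture.FinalStateConjecture.Theorems.SymplecticDualOfTheBomb

end
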